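import Summits.ValiantsHypothesis.ValiantsHypothesis.Theorems.LacunarySymmetroidMatrixDescartesDoorA26WallBubblingMixTop

/-!
# Wall bubbling for `DoorA26` — TWO WEYL PAIRS: THE MIXED CLASS, MID RULE (face form) — `MixMid26` IS A LEMMA

HONEST FRAMING.  Obligation (W) `stub_weylFaces` of `Cruxes/DoorA26/Lines/wall_bubbling.lean` (crux `DoorA26`, stmt-ValiantsHypothesis-19979; OPEN,
typed, never asserted); W1 seat val-sym-door-p2 g14, second of the three face-form mixed-class rules of rev 8 of
`Cruxes/DoorA26/Lines/wall_bubbling_ConfluentDoor.lean` (hypothesis `hMixMid` of W1 #52 `twoPair_noTwenties_of_mixedRules`):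

* **`mixMid_face`** `(δ0) (h50 : δ0 5 = δ0 0) (h41 : δ0 4 = δ0 1) … : (Γ 0 4 ≠ 0 ∨ Γ 5 1 ≠ 0) → Γ' 5 4 = 0` — so `MixMid26` of rev 8 is closed by
  `fun δ0 h50 h41 => mixMid_face δ0 h50 h41`.

Mechanism (crit-2 g5's calculus §4 made exact, `mixMid_core`).  With the triangular transfer of W1 #54 `mixed_frameShift`, a degree-1 member alive
upstream (`κμ ≤ |g₀₄|`, say) and the degree-2 member `(5,4)` alive downstream (`κ'μ' ≤ E₀E₁ee'|g₅₄|`) make the three dominated downstream entries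
`g'₀₄, g'₅₁, g'₀₁` read `κ'|g₀₄ + Λg₅₄| ≤ e|g₅₄|`, `κ'|g₅₁ + Λ'g₅₄| ≤ e'|g₅₄|`, `κ'|g₀₁ + Λ'g₀₄ + Λg₅₁ + ΛΛ'g₅₄| ≤ ee'|g₅₄|`; the identity
`ΛΛ'g₅₄ = g₀₁ − N + Λ'(g₀₄ + Λg₅₄) + Λ(g₅₁ + Λ'g₅₄)` then gives `κκ'|Λ||Λ'| ≤ e + κ'|Λ| + κee' + κe|Λ'| + κe'|Λ|` — LINEAR in `|Λ|`, `|Λ'|`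
separately — impossible once `|Λ| > (5/κ'+1)e + 6/κ` and `|Λ'| > (5/κ'+1)e' + 6/κ` (W2's `eventually_dslope_exp_gt`).  No symmetry of the letters,
no value-genericity needed.

Registers unchanged; (W), `ConfluentDoor26`, `NoTightChain26(NC)`, `MixThree26`, `DoorA26` 19979, 18050 OPEN, typed never asserted; nothing on VP ≠ VNP.
Def-free.  `--supports stmt-ValiantsHypothesis-19979 --as helper`.  [this work]
-/

-- `Summit.ValiantsHypothesis.ValiantsHypothesis.…` repeats a component by the D-0017 layout
-- (single-conjunct summit), which the `dupNamespace` linter flags; the name is mandated.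
set_option linter.dupNamespace false

namespace Summit.ValiantsHypothesis.ValiantsHypothesis.Theorems.LacunarySymmetroidMatrixDescartes.WallBubbling

open Finset Filter Topology
open Bubbling (polar polar_apply polar_comm polar_smul_left_right)
open scoped BigOperators

/-! ## 1. Scalar core -/

/-- Core of the mid rule.  `gA` is the alive upstream degree-1 entry (`g₀₄` or `g₅₁`), `gB` the other one; `Λ`, `e` are the transvection /
weight attached to `gA`'s dead index and `Λ'`, `e'` those of `gB`'s (so for `gA = g₀₄`: `Λ = Λ₀₅`, `e' = e^{w'L}` is `g'₀₄`'s weight, etc.).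
Degree-2 alive downstream + the three dominations ⇒ `κκ'|Λ||Λ'| ≤ e + κ'|Λ| + κee' + κe|Λ'| + κe'|Λ|`, absurd for large `|Λ|, |Λ'|`. [this work] -/
theorem mixMid_core {κ κ' μ μ' E e e' Λ Λ' gA gB g₀₁ g₅₄ : ℝ} (hκ : 0 < κ) (hκ' : 0 < κ') (hμ : 0 < μ) (hE : 0 < E) (he : 0 < e)
    (he' : 0 < e') (hA : κ * μ ≤ |gA|) (h01 : |g₀₁| ≤ μ)
    (halive : κ' * μ' ≤ E * (e * e') * |g₅₄|)
    (hdomA : E * e' * |gA + Λ * g₅₄| ≤ μ') (hdomB : E * e * |gB + Λ' * g₅₄| ≤ μ')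
    (hdom01 : E * |g₀₁ + Λ' * gA + Λ * gB + Λ * Λ' * g₅₄| ≤ μ')
    (hΛ : (5 / κ' + 1) * e + 6 / κ < |Λ|) (hΛ' : (5 / κ' + 1) * e' + 6 / κ < |Λ'|) : False := by
  have hx0 : 0 ≤ |Λ| := abs_nonneg _
  have hy0 : 0 ≤ |Λ'| := abs_nonneg _
  have hg0 : 0 ≤ |g₅₄| := abs_nonneg _
  -- strip the weights
  have h1 : κ' * |gA + Λ * g₅₄| ≤ e * |g₅₄| := by
    have t : κ' * (E * e' * |gA + Λ * g₅₄|) ≤ E * (e * e') * |g₅₄| := le_trans (mul_le_mul_of_nonneg_left hdomA hκ'.le) halive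
    have t' : (E * e') * (κ' * |gA + Λ * g₅₄|) ≤ (E * e') * (e * |g₅₄|) := by linarith
    exact le_of_mul_le_mul_left t' (mul_pos hE he')
  have h2 : κ' * |gB + Λ' * g₅₄| ≤ e' * |g₅₄| := by
    have t : κ' * (E * e * |gB + Λ' * g₅₄|) ≤ E * (e * e') * |g₅₄| := le_trans (mul_le_mul_of_nonneg_left hdomB hκ'.le) halive
    have t' : (E * e) * (κ' * |gB + Λ' * g₅₄|) ≤ (E * e) * (e' * |g₅₄|) := by linarith
    exact le_of_mul_le_mul_left t' (mul_pos hE he)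
  have h3 : κ' * |g₀₁ + Λ' * gA + Λ * gB + Λ * Λ' * g₅₄| ≤ e * e' * |g₅₄| := by
    have t : κ' * (E * |g₀₁ + Λ' * gA + Λ * gB + Λ * Λ' * g₅₄|) ≤ E * (e * e') * |g₅₄| :=
      le_trans (mul_le_mul_of_nonneg_left hdom01 hκ'.le) halive
    have t' : E * (κ' * |g₀₁ + Λ' * gA + Λ * gB + Λ * Λ' * g₅₄|) ≤ E * (e * e' * |g₅₄|) := by linarith
    exact le_of_mul_le_mul_left t' hE
  -- the identity `ΛΛ'g₅₄ = (g₀₁ − N) + (Λ'(gA + Λg₅₄) + Λ(gB + Λ'g₅₄))` in absolute values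
  have h4 : |Λ| * |Λ'| * |g₅₄| ≤ |g₀₁| + |g₀₁ + Λ' * gA + Λ * gB + Λ * Λ' * g₅₄| + |Λ'| * |gA + Λ * g₅₄| + |Λ| * |gB + Λ' * g₅₄| := by
    have eq : Λ * Λ' * g₅₄ = (g₀₁ - (g₀₁ + Λ' * gA + Λ * gB + Λ * Λ' * g₅₄)) + (Λ' * (gA + Λ * g₅₄) + Λ * (gB + Λ' * g₅₄)) := by ring
    have t0 : |Λ * Λ' * g₅₄| = |(g₀₁ - (g₀₁ + Λ' * gA + Λ * gB + Λ * Λ' * g₅₄)) + (Λ' * (gA + Λ * g₅₄) + Λ * (gB + Λ' * g₅₄))| :=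
      congrArg _ eq
    have t1 := abs_add_le (g₀₁ - (g₀₁ + Λ' * gA + Λ * gB + Λ * Λ' * g₅₄)) (Λ' * (gA + Λ * g₅₄) + Λ * (gB + Λ' * g₅₄))
    have t2 := abs_sub g₀₁ (g₀₁ + Λ' * gA + Λ * gB + Λ * Λ' * g₅₄)
    have t3 := abs_add_le (Λ' * (gA + Λ * g₅₄)) (Λ * (gB + Λ' * g₅₄))
    rw [abs_mul, abs_mul] at t3
    have t4 : |Λ * Λ' * g₅₄| = |Λ| * |Λ'| * |g₅₄| := by rw [abs_mul, abs_mul]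
    linarith
  -- multiply by `κ'` and use h1–h3
  have h5 : κ' * (|Λ| * |Λ'| * |g₅₄|) ≤ κ' * μ + e * e' * |g₅₄| + |Λ'| * (e * |g₅₄|) + |Λ| * (e' * |g₅₄|) := by
    have s0 := mul_le_mul_of_nonneg_left h4 hκ'.le
    have s1 := mul_le_mul_of_nonneg_left h1 hy0
    have s2 := mul_le_mul_of_nonneg_left h2 hx0
    have s3 := mul_le_mul_of_nonneg_left h01 hκ'.le
    linarith
  -- `κκ'μ ≤ e|g| + κ'|Λ||g|` from `κμ ≤ |gA| ≤ |gA + Λg| + |Λ||g|`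
  have h6 : κ * κ' * μ ≤ e * |g₅₄| + κ' * |Λ| * |g₅₄| := by
    have t : |gA| ≤ |gA + Λ * g₅₄| + |Λ| * |g₅₄| := by
      have := abs_sub_abs_le_abs_sub gA (gA + Λ * g₅₄)
      rw [show gA - (gA + Λ * g₅₄) = -(Λ * g₅₄) by ring, abs_neg, abs_mul] at this
      linarith
    have s := mul_le_mul_of_nonneg_left (le_trans hA t) hκ'.le
    linarith
  -- `|g₅₄| > 0`
  have hg : 0 < |g₅₄| := by
    rcases hg0.lt_or_eq with h | h
    · exact h
    · have hpos : 0 < e * |g₅₄| + κ' * |Λ| * |g₅₄| := lt_of_lt_of_le (by positivity) h6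
      rw [← h] at hpos
      simp at hpos
  -- (6): `κκ'|Λ||Λ'| ≤ e + κ'|Λ| + κee' + κe|Λ'| + κe'|Λ|`
  have h7 : (κ * κ' * |Λ| * |Λ'|) * |g₅₄| ≤ (e + κ' * |Λ| + κ * (e * e') + κ * e * |Λ'| + κ * e' * |Λ|) * |g₅₄| := by
    have s := mul_le_mul_of_nonneg_left h5 hκ.le
    linarith
  have h8 : κ * κ' * |Λ| * |Λ'| ≤ e + κ' * |Λ| + κ * (e * e') + κ * e * |Λ'| + κ * e' * |Λ| := le_of_mul_le_mul_right h7 hg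
  -- thresholds
  have i1 : κ' * (1 / κ') = 1 := mul_one_div_cancel hκ'.ne'
  have i2 : κ * (1 / κ) = 1 := mul_one_div_cancel hκ.ne'
  have T4 : 5 * e < κ' * |Λ| := by
    have t := mul_lt_mul_of_pos_left hΛ hκ'
    have eq : κ' * ((5 / κ' + 1) * e + 6 / κ) = 5 * e + κ' * e + 6 * (κ' * (1 / κ)) := by
      rw [← mul_one_div (5 : ℝ) κ', ← mul_one_div (6 : ℝ) κ]
      linear_combination (5 * e) * i1
    rw [eq] at t
    have : 0 ≤ 6 * (κ' * (1 / κ)) := by positivity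
    have : 0 ≤ κ' * e := by positivity
    linarith
  have T1 : 5 * e' < κ' * |Λ'| := by
    have t := mul_lt_mul_of_pos_left hΛ' hκ'
    have eq : κ' * ((5 / κ' + 1) * e' + 6 / κ) = 5 * e' + κ' * e' + 6 * (κ' * (1 / κ)) := by
      rw [← mul_one_div (5 : ℝ) κ', ← mul_one_div (6 : ℝ) κ]
      linear_combination (5 * e') * i1
    rw [eq] at t
    have : 0 ≤ 6 * (κ' * (1 / κ)) := by positivity
    have : 0 ≤ κ' * e' := by positivity
    linarith
  have T2 : e' < |Λ'| := by
    have : 0 ≤ 5 / κ' * e' := by positivity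
    have : 0 ≤ 6 / κ := by positivity
    nlinarith
  have T3 : 6 < κ * |Λ'| := by
    have t := mul_lt_mul_of_pos_left hΛ' hκ
    have eq : κ * ((5 / κ' + 1) * e' + 6 / κ) = κ * ((5 / κ' + 1) * e') + 6 := by
      rw [← mul_one_div (6 : ℝ) κ]
      linear_combination 6 * i2
    rw [eq] at t
    have : 0 ≤ κ * ((5 / κ' + 1) * e') := by positivity
    linarith
  -- each of the five terms is `< κκ'|Λ||Λ'|/5`; write `a = κ'|Λ|`, `b = κ|Λ'|`
  have ha : 5 * e < κ' * |Λ| := T4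
  have ha0 : 0 < κ' * |Λ| := lt_trans (by positivity) T4
  have hb0 : 0 < κ * |Λ'| := lt_trans (by norm_num) T3
  have hxpos : 0 < |Λ| := by
    rcases hx0.lt_or_eq with h | h
    · exact h
    · rw [← h, mul_zero] at ha0; exact absurd ha0 (lt_irrefl _)
  have P_eq : κ * κ' * |Λ| * |Λ'| = (κ' * |Λ|) * (κ * |Λ'|) := by ring
  have b1 : 5 * e < κ * κ' * |Λ| * |Λ'| := by
    rw [P_eq]
    have s := mul_lt_mul_of_pos_right ha hb0   -- 5e·b < a·b
    have s' : 5 * e * 1 ≤ 5 * e * (κ * |Λ'|) := mul_le_mul_of_nonneg_left (by linarith) (by positivity)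
    linarith
  have b2 : 5 * (κ' * |Λ|) < κ * κ' * |Λ| * |Λ'| := by
    rw [P_eq]
    have s := mul_lt_mul_of_pos_left (show (5 : ℝ) < κ * |Λ'| by linarith) ha0
    linarith
  have b3 : 5 * (κ * (e * e')) < κ * κ' * |Λ| * |Λ'| := by
    rw [P_eq]
    -- `a·b > 5e·b = 5e·κ|Λ'| > 5eκ e'`
    have s := mul_lt_mul_of_pos_right ha hb0
    have s' : 5 * e * (κ * e') ≤ 5 * e * (κ * |Λ'|) :=
      mul_le_mul_of_nonneg_left (mul_le_mul_of_nonneg_left T2.le hκ.le) (by positivity)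
    nlinarith
  have b4 : 5 * (κ * e * |Λ'|) < κ * κ' * |Λ| * |Λ'| := by
    rw [P_eq]
    have s := mul_lt_mul_of_pos_right ha hb0
    linarith
  have b5 : 5 * (κ * e' * |Λ|) < κ * κ' * |Λ| * |Λ'| := by
    have s := mul_lt_mul_of_pos_right T1 (mul_pos hκ hxpos)   -- 5e'·(κ|Λ|) < κ'|Λ'|·(κ|Λ|)
    linarith
  linarith

/-! ## 2. The mid rule at one stage -/

/-- THE MID RULE AT ONE STAGE (letters `U`, exponents `δ`, shift `L`, explicit frames): an upstream alive degree-1 member, the three downstream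
dominations `|g'₀₄|, |g'₅₁|, |g'₀₁| ≤ μ'`, large `|Λ|, |Λ'|`, and the degree-2 member `(5,4)` alive downstream are contradictory. [this work] -/
theorem mixMid_stage (δ : Fin 6 → ℝ) (U : Fin 6 → Matrix (Fin 2) (Fin 2) ℝ) (L μ μ' κ κ' : ℝ) (hμ : 0 < μ) (hκ : 0 < κ) (hκ' : 0 < κ')
    (hup : κ * μ ≤ |polar (U 0 + U 5) ((δ 4 - δ 1) • U 4)| ∨ κ * μ ≤ |polar ((δ 5 - δ 0) • U 5) (U 1 + U 4)|)
    (h01 : |polar (U 0 + U 5) (U 1 + U 4)| ≤ μ)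
    (hdom04 : |polar (Real.exp (δ 0 * L) • U 0 + Real.exp (δ 5 * L) • U 5) ((δ 4 - δ 1) • (Real.exp (δ 4 * L) • U 4))| ≤ μ')
    (hdom51 : |polar ((δ 5 - δ 0) • (Real.exp (δ 5 * L) • U 5)) (Real.exp (δ 1 * L) • U 1 + Real.exp (δ 4 * L) • U 4)| ≤ μ')
    (hdom01 : |polar (Real.exp (δ 0 * L) • U 0 + Real.exp (δ 5 * L) • U 5) (Real.exp (δ 1 * L) • U 1 + Real.exp (δ 4 * L) • U 4)| ≤ μ')
    (hΛ : (5 / κ' + 1) * Real.exp ((δ 5 - δ 0) * L) + 6 / κ < |dslope (fun y : ℝ => Real.exp (y * L)) 0 (δ 5 - δ 0)|)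
    (hΛ' : (5 / κ' + 1) * Real.exp ((δ 4 - δ 1) * L) + 6 / κ < |dslope (fun y : ℝ => Real.exp (y * L)) 0 (δ 4 - δ 1)|)
    (halive : κ' * μ' ≤ |polar ((δ 5 - δ 0) • (Real.exp (δ 5 * L) • U 5)) ((δ 4 - δ 1) • (Real.exp (δ 4 * L) • U 4))|) : False := by
  obtain ⟨i54, i04, i51, i01⟩ := mixed_frameShift δ U L
  have hEpos : 0 < Real.exp (δ 0 * L) * Real.exp (δ 1 * L) := mul_pos (Real.exp_pos _) (Real.exp_pos _)
  have hepos : 0 < Real.exp ((δ 5 - δ 0) * L) := Real.exp_pos _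
  have he'pos : 0 < Real.exp ((δ 4 - δ 1) * L) := Real.exp_pos _
  rw [i04, abs_mul, abs_of_pos (mul_pos hEpos he'pos)] at hdom04
  rw [i51, abs_mul, abs_of_pos (mul_pos hEpos hepos)] at hdom51
  rw [i01, abs_mul, abs_of_pos hEpos] at hdom01
  rw [i54, abs_mul, abs_of_pos (mul_pos hEpos (mul_pos hepos he'pos))] at halive
  rcases hup with h | h
  · -- `(0,4)` alive upstream: `gA = g₀₄`, `Λ = Λ₀₅`, weight `e'`
    have hdom01' : Real.exp (δ 0 * L) * Real.exp (δ 1 * L) *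
        |polar (U 0 + U 5) (U 1 + U 4) + dslope (fun y : ℝ => Real.exp (y * L)) 0 (δ 4 - δ 1) * polar (U 0 + U 5) ((δ 4 - δ 1) • U 4)
          + dslope (fun y : ℝ => Real.exp (y * L)) 0 (δ 5 - δ 0) * polar ((δ 5 - δ 0) • U 5) (U 1 + U 4)
          + dslope (fun y : ℝ => Real.exp (y * L)) 0 (δ 5 - δ 0) * dslope (fun y : ℝ => Real.exp (y * L)) 0 (δ 4 - δ 1)
            * polar ((δ 5 - δ 0) • U 5) ((δ 4 - δ 1) • U 4)| ≤ μ' := hdom01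
    exact mixMid_core hκ hκ' hμ hEpos hepos he'pos h h01 halive hdom04 hdom51 hdom01' hΛ hΛ'
  · -- `(5,1)` alive upstream: `gA = g₅₁`, `Λ = Λ₁₄`, weight `e`
    have halive' : κ' * μ' ≤ Real.exp (δ 0 * L) * Real.exp (δ 1 * L) * (Real.exp ((δ 4 - δ 1) * L) * Real.exp ((δ 5 - δ 0) * L))
        * |polar ((δ 5 - δ 0) • U 5) ((δ 4 - δ 1) • U 4)| := by
      rw [mul_comm (Real.exp ((δ 4 - δ 1) * L))]; exact halive
    have hdom01' : Real.exp (δ 0 * L) * Real.exp (δ 1 * L) *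
        |polar (U 0 + U 5) (U 1 + U 4) + dslope (fun y : ℝ => Real.exp (y * L)) 0 (δ 5 - δ 0) * polar ((δ 5 - δ 0) • U 5) (U 1 + U 4)
          + dslope (fun y : ℝ => Real.exp (y * L)) 0 (δ 4 - δ 1) * polar (U 0 + U 5) ((δ 4 - δ 1) • U 4)
          + dslope (fun y : ℝ => Real.exp (y * L)) 0 (δ 4 - δ 1) * dslope (fun y : ℝ => Real.exp (y * L)) 0 (δ 5 - δ 0)
            * polar ((δ 5 - δ 0) • U 5) ((δ 4 - δ 1) • U 4)| ≤ μ' := by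
      refine le_of_eq_of_le ?_ hdom01
      congr 2; ring
    exact mixMid_core hκ hκ' hμ hEpos he'pos hepos h h01 halive' hdom51 hdom04 hdom01' hΛ' hΛ

/-! ## 3. The mid rule -/

/-- **THE MIXED CLASS `δ₀+δ₁`, MID RULE (face form) — `MixMid26` of rev 8 of `Lines/wall_bubbling_ConfluentDoor.lean` IS A THEOREM.**
Hypotheses verbatim those of W1 #54 `mixTop_face` (= the binder `hMixMid` of W1 #52).  If a degree-1 member `(0,4)` or `(5,1)` of the mixed class is
alive in the first Gram-normalised limit, the degree-2 member `(5,4)` is dead in the second. [this work] -/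
theorem mixMid_face (δ0 : Fin 6 → ℝ) (h50 : δ0 5 = δ0 0) (h41 : δ0 4 = δ0 1)
    (δs : ℕ → Fin 6 → ℝ) (hδ : ∀ l, Tendsto (fun ν => δs ν l) atTop (𝓝 (δ0 l)))
    (U : ℕ → Fin 6 → Matrix (Fin 2) (Fin 2) ℝ) (L : ℕ → ℝ) (hL : Tendsto L atTop atTop)
    (μ μ' : ℕ → ℝ) (hμ : ∀ ν, 0 < μ ν) (hμ' : ∀ ν, 0 < μ' ν)
    (hdom : ∀ ν a b, |polar (if a = 0 then U ν 0 + U ν 5 else if a = 1 then U ν 1 + U ν 4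
        else if a = 4 then (δs ν 4 - δs ν 1) • U ν 4 else if a = 5 then (δs ν 5 - δs ν 0) • U ν 5 else U ν a)
      (if b = 0 then U ν 0 + U ν 5 else if b = 1 then U ν 1 + U ν 4
        else if b = 4 then (δs ν 4 - δs ν 1) • U ν 4 else if b = 5 then (δs ν 5 - δs ν 0) • U ν 5 else U ν b)| ≤ μ ν)
    (hdom' : ∀ ν a b, |polar (if a = 0 then Real.exp (δs ν 0 * L ν) • U ν 0 + Real.exp (δs ν 5 * L ν) • U ν 5
        else if a = 1 then Real.exp (δs ν 1 * L ν) • U ν 1 + Real.exp (δs ν 4 * L ν) • U ν 4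
        else if a = 4 then (δs ν 4 - δs ν 1) • (Real.exp (δs ν 4 * L ν) • U ν 4)
        else if a = 5 then (δs ν 5 - δs ν 0) • (Real.exp (δs ν 5 * L ν) • U ν 5) else Real.exp (δs ν a * L ν) • U ν a)
      (if b = 0 then Real.exp (δs ν 0 * L ν) • U ν 0 + Real.exp (δs ν 5 * L ν) • U ν 5
        else if b = 1 then Real.exp (δs ν 1 * L ν) • U ν 1 + Real.exp (δs ν 4 * L ν) • U ν 4
        else if b = 4 then (δs ν 4 - δs ν 1) • (Real.exp (δs ν 4 * L ν) • U ν 4)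
        else if b = 5 then (δs ν 5 - δs ν 0) • (Real.exp (δs ν 5 * L ν) • U ν 5) else Real.exp (δs ν b * L ν) • U ν b)| ≤ μ' ν)
    (Γ Γ' : Fin 6 → Fin 6 → ℝ)
    (hΓ : ∀ a b, Tendsto (fun ν => polar (if a = 0 then U ν 0 + U ν 5 else if a = 1 then U ν 1 + U ν 4
        else if a = 4 then (δs ν 4 - δs ν 1) • U ν 4 else if a = 5 then (δs ν 5 - δs ν 0) • U ν 5 else U ν a)
      (if b = 0 then U ν 0 + U ν 5 else if b = 1 then U ν 1 + U ν 4
        else if b = 4 then (δs ν 4 - δs ν 1) • U ν 4 else if b = 5 then (δs ν 5 - δs ν 0) • U ν 5 else U ν b) / μ ν) atTop (𝓝 (Γ a b)))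
    (hΓ' : ∀ a b, Tendsto (fun ν => polar (if a = 0 then Real.exp (δs ν 0 * L ν) • U ν 0 + Real.exp (δs ν 5 * L ν) • U ν 5
        else if a = 1 then Real.exp (δs ν 1 * L ν) • U ν 1 + Real.exp (δs ν 4 * L ν) • U ν 4
        else if a = 4 then (δs ν 4 - δs ν 1) • (Real.exp (δs ν 4 * L ν) • U ν 4)
        else if a = 5 then (δs ν 5 - δs ν 0) • (Real.exp (δs ν 5 * L ν) • U ν 5) else Real.exp (δs ν a * L ν) • U ν a)
      (if b = 0 then Real.exp (δs ν 0 * L ν) • U ν 0 + Real.exp (δs ν 5 * L ν) • U ν 5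
        else if b = 1 then Real.exp (δs ν 1 * L ν) • U ν 1 + Real.exp (δs ν 4 * L ν) • U ν 4
        else if b = 4 then (δs ν 4 - δs ν 1) • (Real.exp (δs ν 4 * L ν) • U ν 4)
        else if b = 5 then (δs ν 5 - δs ν 0) • (Real.exp (δs ν 5 * L ν) • U ν 5) else Real.exp (δs ν b * L ν) • U ν b) / μ' ν) atTop (𝓝 (Γ' a b))) :
    (Γ 0 4 ≠ 0 ∨ Γ 5 1 ≠ 0) → Γ' 5 4 = 0 := by
  intro hup
  have f50 : ((5 : Fin 6) = 0) = False := by simp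
  have f51 : ((5 : Fin 6) = 1) = False := by simp
  have f54 : ((5 : Fin 6) = 4) = False := by simp
  have f40 : ((4 : Fin 6) = 0) = False := by simp
  have f41 : ((4 : Fin 6) = 1) = False := by simp
  have f10 : ((1 : Fin 6) = 0) = False := by simp
  have hw0 : Tendsto (fun ν => δs ν 5 - δs ν 0) atTop (𝓝 0) := by
    have := (hδ 5).sub (hδ 0)
    rw [h50, sub_self] at this
    exact this
  have hw1 : Tendsto (fun ν => δs ν 4 - δs ν 1) atTop (𝓝 0) := by
    have := (hδ 4).sub (hδ 1)
    rw [h41, sub_self] at this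
    exact this
  -- the level `κ` of the alive upstream member
  obtain ⟨κ, hκpos, e1⟩ : ∃ κ : ℝ, 0 < κ ∧ ∀ᶠ ν in atTop,
      (κ * μ ν ≤ |polar (U ν 0 + U ν 5) ((δs ν 4 - δs ν 1) • U ν 4)| ∨
        κ * μ ν ≤ |polar ((δs ν 5 - δs ν 0) • U ν 5) (U ν 1 + U ν 4)|) := by
    rcases hup with h1 | h1
    · refine ⟨|Γ 0 4| / 2, half_pos (abs_pos.mpr h1), ?_⟩
      have h := ((hΓ 0 4).abs).eventually_const_lt (show |Γ 0 4| / 2 < |Γ 0 4| by linarith [abs_pos.mpr h1])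
      filter_upwards [h] with ν hν
      left
      simp only [f40, f41, if_false, if_true] at hν
      rw [abs_div, abs_of_pos (hμ ν), lt_div_iff₀ (hμ ν)] at hν
      exact hν.le
    · refine ⟨|Γ 5 1| / 2, half_pos (abs_pos.mpr h1), ?_⟩
      have h := ((hΓ 5 1).abs).eventually_const_lt (show |Γ 5 1| / 2 < |Γ 5 1| by linarith [abs_pos.mpr h1])
      filter_upwards [h] with ν hν
      right
      simp only [f50, f51, f54, f10, if_false, if_true] at hν
      rw [abs_div, abs_of_pos (hμ ν), lt_div_iff₀ (hμ ν)] at hν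
      exact hν.le
  by_contra hne
  set κ' : ℝ := |Γ' 5 4| / 2 with hκ'
  have hκ'pos : 0 < κ' := by rw [hκ']; exact half_pos (abs_pos.mpr hne)
  have e2 : ∀ᶠ ν in atTop, κ' * μ' ν ≤ |polar ((δs ν 5 - δs ν 0) • (Real.exp (δs ν 5 * L ν) • U ν 5))
      ((δs ν 4 - δs ν 1) • (Real.exp (δs ν 4 * L ν) • U ν 4))| := by
    have h := ((hΓ' 5 4).abs).eventually_const_lt (show κ' < |Γ' 5 4| by rw [hκ']; linarith [abs_pos.mpr hne])
    filter_upwards [h] with ν hν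
    simp only [f50, f51, f54, f40, f41, if_false, if_true] at hν
    rw [abs_div, abs_of_pos (hμ' ν), lt_div_iff₀ (hμ' ν)] at hν
    exact hν.le
  have eaΛ : ∀ᶠ ν in atTop, (5 / κ' + 1) * Real.exp ((δs ν 5 - δs ν 0) * L ν) + (6 / κ)
      < |dslope (fun y : ℝ => Real.exp (y * L ν)) 0 (δs ν 5 - δs ν 0)| :=
    eventually_dslope_exp_gt (fun ν => δs ν 5 - δs ν 0) L hw0 hL (5 / κ' + 1) (6 / κ) (by positivity) (by positivity)
  have eaΛ' : ∀ᶠ ν in atTop, (5 / κ' + 1) * Real.exp ((δs ν 4 - δs ν 1) * L ν) + (6 / κ)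
      < |dslope (fun y : ℝ => Real.exp (y * L ν)) 0 (δs ν 4 - δs ν 1)| :=
    eventually_dslope_exp_gt (fun ν => δs ν 4 - δs ν 1) L hw1 hL (5 / κ' + 1) (6 / κ) (by positivity) (by positivity)
  have hfalse : ∀ᶠ ν : ℕ in atTop, False := by
    filter_upwards [e1, e2, eaΛ, eaΛ'] with ν hν1 hν2 hνaΛ hνaΛ'
    have h01le := hdom ν 0 1
    simp only [f10, if_false, if_true] at h01le
    have hdom04 := hdom' ν 0 4
    simp only [f40, f41, if_false, if_true] at hdom04
    have hdom51 := hdom' ν 5 1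
    simp only [f50, f51, f54, f10, if_false, if_true] at hdom51
    have hdom01 := hdom' ν 0 1
    simp only [f10, if_false, if_true] at hdom01
    exact mixMid_stage (δs ν) (U ν) (L ν) (μ ν) (μ' ν) κ κ' (hμ ν) hκpos hκ'pos hν1 h01le hdom04 hdom51 hdom01 hνaΛ hνaΛ' hν2
  exact hfalse.exists.elim fun _ h => h

end Summit.ValiantsHypothesis.ValiantsHypothesis.Theorems.LacunarySymmetroidMatrixDescartes.WallBubbling
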